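import Summits.Ventures.YMGap.Census.Decimation
import Summits.Ventures.YMGap.Census.DecimationPositivity
import Summits.Ventures.YMGap.Census.DecimationLowerBound
import HarnessLib

/-!
# Venture YMGap, track (b) census — Tomboulis's upper-bound decimation ITERATED: `n` steps `(ℤ/b^nLℤ)^d → ⋯ → (ℤ/Lℤ)^d` at `r = 1`

HONEST FRAMING: venture file of the cell `pub-ymgap` (QuantumFields programme), track (b) census.  Exact statement about finite tori; nothing
about (5.15), confinement or any limit (in particular nothing about `n → ∞`).

Tomboulis (arXiv:0707.2179 §3.1, (3.1)–(3.4): "after `n` successive decimations … `Z_Λ({c_j}) ≤ ∏_{m=1}^{n} F₀^U(m)^{|Λ^{(m)}|} Z_{Λ^{(n)}}({c^U_j(n, r)})`",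
the scheme (2.17)–(2.22) iterated with `ζ = b^{d-2}`).  KERNEL at `r = 1` on the positivity domain: the decimated coefficients of
`decimationUpperBound_of_nonneg` are again admissible with a non-negative plaquette function (`coeffAdmissible_mkCoeff_one_of_nonneg`,
`plaqFn_mkCoeff_one_nonneg`), so the one-step bound iterates.  `iterJ`, `iterCoeff` — the cut-offs `b^{(d-2)m} J` and coefficients `c^U(m, 1)`;
`iterBulk` — the accumulated bulk factor `∏_{m<n} F₀^U(m+1)^{|Λ^{(m+1)}|}` (with `|Λ| = d(d-1)/2 · side^d` plaquettes);
`decimationUpperBound_iter` — **`Z_{(ℤ/b^nL)^d}({c_j}) ≤ iterBulk n L · Z_{(ℤ/L)^d}({c^U_j(n,1)})`** for every `d`, `b ≥ 1`, `L ≥ 1`, `n`, `J`,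
admissible `c` with `f_c ≥ 0`. [cite: Tomboulis2007Confinement, §3.1 eqs. (3.1)–(3.4)]
-/

noncomputable section

open MeasureTheory Finset Real
open scoped BigOperators
open Literature.MathematicalPhysics.QuantumLattice
open Literature.MathematicalPhysics.QuantumFieldTheory
open Literature.MathematicalPhysics.QuantumFieldTheory.Tomboulis2007

namespace Summit.Ventures.YMGap.Census

variable {d : ℕ} (b : ℕ)

/-- The spin cut-off after `m` steps: `J_m = (b^{d-2})^m J`. -/
def iterJ (d J : ℕ) : ℕ → ℕ
  | 0 => J
  | m + 1 => b ^ (d - 2) * iterJ d J m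

/-- The upper-bound coefficients after `m` steps at `r = 1`: `c^U(0) = c`, `c^U(m+1) = (c^U(m))^U(1, 1)`. -/
def iterCoeff (d J : ℕ) (c : ℕ → ℝ) : ℕ → (ℕ → ℝ)
  | 0 => c
  | m + 1 => mkCoeff (iterJ b d J m) (iterCoeff d J c m) (b ^ (d - 2)) b 1

/-- The accumulated bulk factor of `n` steps ending on the torus of side `L`:
`B(0, L) = 1`, `B(n+1, L) = B(n, bL) · F₀^U(c^U(n))^{d(d-1)/2 · L^d}` (the last step is `(ℤ/bL)^d → (ℤ/L)^d`). -/
def iterBulk (d J : ℕ) (c : ℕ → ℝ) : ℕ → ℕ → ℝ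
  | 0, _ => 1
  | n + 1, L => iterBulk d J c n (b * L) * mkF0 (iterJ b d J n) (iterCoeff b d J c n) (b ^ (d - 2)) b ^ (d * (d - 1) / 2 * L ^ d)

variable {b} [NeZero b]

/-- Along the iteration the coefficients stay admissible and the plaquette function stays non-negative (arXiv:0707.2179 (2.21), (2.34)). -/
theorem iterCoeff_admissible_nonneg (J : ℕ) {c : ℕ → ℝ} (hc : CoeffAdmissible c) (hf : ∀ g : SU2, 0 ≤ plaqFn J c g) (m : ℕ) :
    CoeffAdmissible (iterCoeff b d J c m) ∧ ∀ g : SU2, 0 ≤ plaqFn (iterJ b d J m) (iterCoeff b d J c m) g := by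
  induction m with
  | zero => exact ⟨hc, hf⟩
  | succ m ih =>
    have hc' : ∀ n, 1 ≤ n → 0 ≤ iterCoeff b d J c m n := fun n hn => (ih.1 n hn).1
    exact ⟨coeffAdmissible_mkCoeff_one_of_nonneg hc' ih.2 _ b, fun g => plaqFn_mkCoeff_one_nonneg hc' ih.2 _ b g⟩

/-- The bulk factor is at least `1`. -/
theorem one_le_iterBulk (J : ℕ) {c : ℕ → ℝ} (hc : CoeffAdmissible c) (hf : ∀ g : SU2, 0 ≤ plaqFn J c g) (n : ℕ) :
    ∀ L : ℕ, 1 ≤ iterBulk b d J c n L := by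
  induction n with
  | zero => intro L; simp [iterBulk]
  | succ n ih =>
    intro L
    have hc' : ∀ k, 1 ≤ k → 0 ≤ iterCoeff b d J c n k := fun k hk => ((iterCoeff_admissible_nonneg J hc hf n).1 k hk).1
    exact one_le_mul_of_one_le_of_one_le (ih (b * L)) (one_le_pow₀ (one_le_mkF0 hc' _ b))

/-- Transport of `Z` along an equality of sides (the instances are propositions). -/
theorem torusZ_side_congr {N N' : ℕ} [NeZero N] [NeZero N'] (h : N = N') (J : ℕ) (c : ℕ → ℝ) : torusZ d N J c = torusZ d N' J c := by
  subst h
  rfl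

/-- `#plaquettes((ℤ/Lℤ)^d) = d(d-1)/2 · L^d`. -/
theorem card_plaquette_eq {L : ℕ} [NeZero L] : Fintype.card (Plaquette d L) = d * (d - 1) / 2 * L ^ d := by
  have h := two_mul_card_plaquette (d := d) (L := L)
  have heven : 2 ∣ d * (d - 1) := by
    rcases Nat.even_or_odd d with ⟨k, hk⟩ | ⟨k, hk⟩
    · exact ⟨k * (d - 1), by rw [hk]; ring⟩
    · exact ⟨d * k, by rw [hk, Nat.add_sub_cancel]; ring⟩
  obtain ⟨q, hq⟩ := heven
  rw [hq, Nat.mul_div_cancel_left q two_pos]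
  rw [hq, mul_assoc] at h
  omega

/-- **Tomboulis's upper-bound decimation iterated `n` times (arXiv:0707.2179 (3.3)–(3.4) at `r = 1`) on the positivity domain**:
`Z_{(ℤ/b^nL)^d}({c_j}) ≤ [∏_{m<n} F₀^U(m+1)^{|Λ^{(m+1)}|}] · Z_{(ℤ/L)^d}({c^U_j(n,1)})` for every `d`, `b ≥ 1`, `L ≥ 1`, `n`, `J` and admissible `c`
with `f_c ≥ 0`, with cut-off `b^{(d-2)n} J` after `n` steps. -/
theorem decimationUpperBound_iter (J : ℕ) {c : ℕ → ℝ} (hc : CoeffAdmissible c) (hf : ∀ g : SU2, 0 ≤ plaqFn J c g) (n : ℕ) :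
    ∀ (L : ℕ) [NeZero L], torusZ d (b ^ n * L) J c ≤ iterBulk b d J c n L * torusZ d L (iterJ b d J n) (iterCoeff b d J c n) := by
  induction n with
  | zero =>
    intro L _
    rw [torusZ_side_congr (show b ^ 0 * L = L by rw [pow_zero, one_mul]) J c]
    simp [iterBulk, iterJ, iterCoeff]
  | succ n ih =>
    intro L _
    have hstep := iterCoeff_admissible_nonneg (b := b) (d := d) J hc hf n
    -- `n` steps down to the torus of side `bL`, then one more step `(ℤ/bL)^d → (ℤ/L)^d`
    calc torusZ d (b ^ (n + 1) * L) J c = torusZ d (b ^ n * (b * L)) J c := torusZ_side_congr (by ring) J c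
      _ ≤ iterBulk b d J c n (b * L) * torusZ d (b * L) (iterJ b d J n) (iterCoeff b d J c n) := ih (b * L)
      _ ≤ iterBulk b d J c n (b * L) * (mkF0 (iterJ b d J n) (iterCoeff b d J c n) (b ^ (d - 2)) b ^ Fintype.card (Plaquette d L) *
            torusZ d L (b ^ (d - 2) * iterJ b d J n) (mkCoeff (iterJ b d J n) (iterCoeff b d J c n) (b ^ (d - 2)) b 1)) :=
          mul_le_mul_of_nonneg_left (decimationUpperBound_of_nonneg _ hstep.1 hstep.2) (zero_le_one.trans (one_le_iterBulk J hc hf n _))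
      _ = iterBulk b d J c (n + 1) L * torusZ d L (iterJ b d J (n + 1)) (iterCoeff b d J c (n + 1)) := by
          rw [card_plaquette_eq]
          simp only [iterBulk, iterJ, iterCoeff]
          ring

end Summit.Ventures.YMGap.Census

end
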